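import Mathlib
import HarnessLib
import Summits.ValiantsHypothesis.ValiantsHypothesis.Theorems.LacunarySymmetroidMatrixDescartesOsculationLawTwoKSupport

/-!
# ValiantsHypothesis / LacunarySymmetroid — crux `MatrixDescartes` (stmt-ValiantsHypothesis-18050, V1),
# line «osculation-law»: the MONIC CUBIC cusp curve — monomial supports

File 4a of the `(r,s) = (3,0)` piece of the `m = 3` rung.  Support bookkeeping (Minkowski sumsets of the exponent set
`E`, `|n • E| ≤ |E|ⁿ`, tools of `…OsculationLawTwoKSupport`) for the remainder polynomials of the monic cubic:
`supp R₂ ⊆ 7•E`, `supp R₁ ⊆ 8•E`, `supp R₀ ⊆ 9•E` (the three explicit polynomials of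
`OsculationCuspCubic.eval_R2/eval_R1/eval_R0`, weights for `wt σᵢ = i`), then — abstractly in `R₂, R₁, R₀` —
`supp L₁ ⊆ 16•E`, `supp L₀ ⊆ 17•E`, `supp N ⊆ 41•E`, `supp N′ ⊆ 27•E`, and the numeric form of the count bound
`|supp N| + |supp N′| + 3(|supp R₂|+|supp R₁|+|supp R₀|+|supp L₁|+|supp L₀|) ≤ 17·K⁴¹` for `|E| ≤ K`.
The proof scripts for the three long polynomials were generated from the same exact-arithmetic engine that produced
the reduction identity and are checked here by the kernel.

Honest framing: helper bookkeeping for a located rung of an UNREGISTERED V1 law line; `OsculationLaw`, `PeelInequality`,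
`MatrixDescartes`, Conjecture B and `VP ≠ VNP` are OPEN / NOT proved.  No definitions, no named facts.
-/

-- `Summit.ValiantsHypothesis.ValiantsHypothesis.…` is the tree's mandated single-conjunct layout (Sub = Summit).
set_option linter.dupNamespace false

noncomputable section

namespace Summit.ValiantsHypothesis.ValiantsHypothesis.Theorems.LacunarySymmetroidMatrixDescartes

open Polynomial
open scoped BigOperators Pointwise
open OsculationCusp

namespace OsculationCuspCubic

set_option maxHeartbeats 4000000 in
/-- `supp R₂ ⊆ 7 • E` (every monomial of `R₂` has `E`-weight `7`). [folklore] -/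
theorem supp_R2 (σ₁ σ₂ σ₃ : ℝ[X]) (E : Finset ℕ) (h1 : σ₁.support ⊆ 1 • E) (h2 : σ₂.support ⊆ 2 • E)
    (h3 : σ₃.support ⊆ 3 • E) :
    (σ₁ ^ 6 * (X * derivative (X * derivative σ₁)) - σ₁ ^ 5 * (X * derivative σ₁) ^ 2 - σ₁ ^ 5 * (X * derivative (X * derivative σ₂)) - 7 * σ₁ ^ 4 * σ₂ * (X * derivative (X * derivative σ₁))
      + 4 * σ₁ ^ 4 * (X * derivative σ₁) * (X * derivative σ₂) + σ₁ ^ 4 * (X * derivative (X * derivative σ₃)) + 3 * σ₁ ^ 3 * σ₂ * (X * derivative σ₁) ^ 2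
      + 6 * σ₁ ^ 3 * σ₂ * (X * derivative (X * derivative σ₂)) + 8 * σ₁ ^ 3 * σ₃ * (X * derivative (X * derivative σ₁)) - 6 * σ₁ ^ 3 * (X * derivative σ₁) * (X * derivative σ₃)
      - 3 * σ₁ ^ 3 * (X * derivative σ₂) ^ 2 + 13 * σ₁ ^ 2 * σ₂ ^ 2 * (X * derivative (X * derivative σ₁)) - 12 * σ₁ ^ 2 * σ₂ * (X * derivative σ₁) * (X * derivative σ₂)
      - 5 * σ₁ ^ 2 * σ₂ * (X * derivative (X * derivative σ₃)) + σ₁ ^ 2 * σ₃ * (X * derivative σ₁) ^ 2 - 7 * σ₁ ^ 2 * σ₃ * (X * derivative (X * derivative σ₂))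
      + 8 * σ₁ ^ 2 * (X * derivative σ₂) * (X * derivative σ₃) - σ₁ * σ₂ ^ 2 * (X * derivative σ₁) ^ 2 - 8 * σ₁ * σ₂ ^ 2 * (X * derivative (X * derivative σ₂))
      - 22 * σ₁ * σ₂ * σ₃ * (X * derivative (X * derivative σ₁)) + 14 * σ₁ * σ₂ * (X * derivative σ₁) * (X * derivative σ₃) + 7 * σ₁ * σ₂ * (X * derivative σ₂) ^ 2
      + 4 * σ₁ * σ₃ * (X * derivative σ₁) * (X * derivative σ₂) + 6 * σ₁ * σ₃ * (X * derivative (X * derivative σ₃)) - 5 * σ₁ * (X * derivative σ₃) ^ 2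
      - 4 * σ₂ ^ 3 * (X * derivative (X * derivative σ₁)) + 4 * σ₂ ^ 2 * (X * derivative σ₁) * (X * derivative σ₂) + 4 * σ₂ ^ 2 * (X * derivative (X * derivative σ₃))
      - 3 * σ₂ * σ₃ * (X * derivative σ₁) ^ 2 + 12 * σ₂ * σ₃ * (X * derivative (X * derivative σ₂)) - 12 * σ₂ * (X * derivative σ₂) * (X * derivative σ₃)
      + 9 * σ₃ ^ 2 * (X * derivative (X * derivative σ₁)) - 6 * σ₃ * (X * derivative σ₁) * (X * derivative σ₃) - 3 * σ₃ * (X * derivative σ₂) ^ 2).support ⊆ 7 • E := by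
  have hT1 : (X * derivative σ₁).support ⊆ 1 • E := supp_theta h1
  have hU1 : (X * derivative (X * derivative σ₁)).support ⊆ 1 • E := supp_theta hT1
  have hT2 : (X * derivative σ₂).support ⊆ 2 • E := supp_theta h2
  have hU2 : (X * derivative (X * derivative σ₂)).support ⊆ 2 • E := supp_theta hT2
  have hT3 : (X * derivative σ₃).support ⊆ 3 • E := supp_theta h3
  have hU3 : (X * derivative (X * derivative σ₃)).support ⊆ 3 • E := supp_theta hT3
  exact (supp_sub (supp_sub (supp_add (supp_sub (supp_add (supp_sub (supp_add (supp_add (supp_sub (supp_sub (supp_add (supp_add (supp_add (supp_add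
    (supp_sub (supp_sub (supp_sub (supp_add (supp_sub (supp_add (supp_sub (supp_sub (supp_add (supp_sub (supp_sub (supp_add (supp_add
    (supp_add (supp_add (supp_add (supp_sub (supp_sub (supp_sub (supp_cast (supp_mul (supp_pow h1 6 (by norm_num)) hU1) (by norm_num))
    (supp_cast (supp_mul (supp_pow h1 5 (by norm_num)) (supp_pow hT1 2 (by norm_num))) (by norm_num))) (supp_cast (supp_mul (supp_pow h1 5
    (by norm_num)) hU2) (by norm_num))) (supp_cast (supp_mul (supp_mul (supp_ofNat_mul 7 (supp_pow h1 4 (by norm_num))) h2) hU1) (by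
    norm_num))) (supp_cast (supp_mul (supp_mul (supp_ofNat_mul 4 (supp_pow h1 4 (by norm_num))) hT1) hT2) (by norm_num))) (supp_cast
    (supp_mul (supp_pow h1 4 (by norm_num)) hU3) (by norm_num))) (supp_cast (supp_mul (supp_mul (supp_ofNat_mul 3 (supp_pow h1 3 (by
    norm_num))) h2) (supp_pow hT1 2 (by norm_num))) (by norm_num))) (supp_cast (supp_mul (supp_mul (supp_ofNat_mul 6 (supp_pow h1 3 (by
    norm_num))) h2) hU2) (by norm_num))) (supp_cast (supp_mul (supp_mul (supp_ofNat_mul 8 (supp_pow h1 3 (by norm_num))) h3) hU1) (by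
    norm_num))) (supp_cast (supp_mul (supp_mul (supp_ofNat_mul 6 (supp_pow h1 3 (by norm_num))) hT1) hT3) (by norm_num))) (supp_cast
    (supp_mul (supp_ofNat_mul 3 (supp_pow h1 3 (by norm_num))) (supp_pow hT2 2 (by norm_num))) (by norm_num))) (supp_cast (supp_mul
    (supp_mul (supp_ofNat_mul 13 (supp_pow h1 2 (by norm_num))) (supp_pow h2 2 (by norm_num))) hU1) (by norm_num))) (supp_cast (supp_mul
    (supp_mul (supp_mul (supp_ofNat_mul 12 (supp_pow h1 2 (by norm_num))) h2) hT1) hT2) (by norm_num))) (supp_cast (supp_mul (supp_mul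
    (supp_ofNat_mul 5 (supp_pow h1 2 (by norm_num))) h2) hU3) (by norm_num))) (supp_cast (supp_mul (supp_mul (supp_pow h1 2 (by norm_num))
    h3) (supp_pow hT1 2 (by norm_num))) (by norm_num))) (supp_cast (supp_mul (supp_mul (supp_ofNat_mul 7 (supp_pow h1 2 (by norm_num))) h3)
    hU2) (by norm_num))) (supp_cast (supp_mul (supp_mul (supp_ofNat_mul 8 (supp_pow h1 2 (by norm_num))) hT2) hT3) (by norm_num)))
    (supp_cast (supp_mul (supp_mul h1 (supp_pow h2 2 (by norm_num))) (supp_pow hT1 2 (by norm_num))) (by norm_num))) (supp_cast (supp_mul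
    (supp_mul (supp_ofNat_mul 8 h1) (supp_pow h2 2 (by norm_num))) hU2) (by norm_num))) (supp_cast (supp_mul (supp_mul (supp_mul
    (supp_ofNat_mul 22 h1) h2) h3) hU1) (by norm_num))) (supp_cast (supp_mul (supp_mul (supp_mul (supp_ofNat_mul 14 h1) h2) hT1) hT3) (by
    norm_num))) (supp_cast (supp_mul (supp_mul (supp_ofNat_mul 7 h1) h2) (supp_pow hT2 2 (by norm_num))) (by norm_num))) (supp_cast
    (supp_mul (supp_mul (supp_mul (supp_ofNat_mul 4 h1) h3) hT1) hT2) (by norm_num))) (supp_cast (supp_mul (supp_mul (supp_ofNat_mul 6 h1)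
    h3) hU3) (by norm_num))) (supp_cast (supp_mul (supp_ofNat_mul 5 h1) (supp_pow hT3 2 (by norm_num))) (by norm_num))) (supp_cast (supp_mul
    (supp_ofNat_mul 4 (supp_pow h2 3 (by norm_num))) hU1) (by norm_num))) (supp_cast (supp_mul (supp_mul (supp_ofNat_mul 4 (supp_pow h2 2
    (by norm_num))) hT1) hT2) (by norm_num))) (supp_cast (supp_mul (supp_ofNat_mul 4 (supp_pow h2 2 (by norm_num))) hU3) (by norm_num)))
    (supp_cast (supp_mul (supp_mul (supp_ofNat_mul 3 h2) h3) (supp_pow hT1 2 (by norm_num))) (by norm_num))) (supp_cast (supp_mul (supp_mul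
    (supp_ofNat_mul 12 h2) h3) hU2) (by norm_num))) (supp_cast (supp_mul (supp_mul (supp_ofNat_mul 12 h2) hT2) hT3) (by norm_num)))
    (supp_cast (supp_mul (supp_ofNat_mul 9 (supp_pow h3 2 (by norm_num))) hU1) (by norm_num))) (supp_cast (supp_mul (supp_mul
    (supp_ofNat_mul 6 h3) hT1) hT3) (by norm_num))) (supp_cast (supp_mul (supp_ofNat_mul 3 h3) (supp_pow hT2 2 (by norm_num))) (by
    norm_num)))

set_option maxHeartbeats 4000000 in
/-- `supp R₁ ⊆ 8 • E` (every monomial of `R₁` has `E`-weight `8`). [folklore] -/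
theorem supp_R1 (σ₁ σ₂ σ₃ : ℝ[X]) (E : Finset ℕ) (h1 : σ₁.support ⊆ 1 • E) (h2 : σ₂.support ⊆ 2 • E)
    (h3 : σ₃.support ⊆ 3 • E) :
    (σ₁ ^ 5 * σ₂ * (X * derivative (X * derivative σ₁)) - σ₁ ^ 4 * σ₂ * (X * derivative σ₁) ^ 2 - σ₁ ^ 4 * σ₂ * (X * derivative (X * derivative σ₂)) - σ₁ ^ 4 * σ₃ * (X * derivative (X * derivative σ₁))
      - 6 * σ₁ ^ 3 * σ₂ ^ 2 * (X * derivative (X * derivative σ₁)) + 4 * σ₁ ^ 3 * σ₂ * (X * derivative σ₁) * (X * derivative σ₂) + σ₁ ^ 3 * σ₂ * (X * derivative (X * derivative σ₃))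
      + σ₁ ^ 3 * σ₃ * (X * derivative σ₁) ^ 2 + σ₁ ^ 3 * σ₃ * (X * derivative (X * derivative σ₂)) + 2 * σ₁ ^ 2 * σ₂ ^ 2 * (X * derivative σ₁) ^ 2 + 5 * σ₁ ^ 2 * σ₂ ^ 2 * (X * derivative (X * derivative σ₂))
      + 12 * σ₁ ^ 2 * σ₂ * σ₃ * (X * derivative (X * derivative σ₁)) - 6 * σ₁ ^ 2 * σ₂ * (X * derivative σ₁) * (X * derivative σ₃) - 3 * σ₁ ^ 2 * σ₂ * (X * derivative σ₂) ^ 2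
      - 4 * σ₁ ^ 2 * σ₃ * (X * derivative σ₁) * (X * derivative σ₂) - σ₁ ^ 2 * σ₃ * (X * derivative (X * derivative σ₃)) + 8 * σ₁ * σ₂ ^ 3 * (X * derivative (X * derivative σ₁))
      - 8 * σ₁ * σ₂ ^ 2 * (X * derivative σ₁) * (X * derivative σ₂) - 4 * σ₁ * σ₂ ^ 2 * (X * derivative (X * derivative σ₃)) + σ₁ * σ₂ * σ₃ * (X * derivative σ₁) ^ 2
      - 10 * σ₁ * σ₂ * σ₃ * (X * derivative (X * derivative σ₂)) + 8 * σ₁ * σ₂ * (X * derivative σ₂) * (X * derivative σ₃) - 6 * σ₁ * σ₃ ^ 2 * (X * derivative (X * derivative σ₁))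
      + 6 * σ₁ * σ₃ * (X * derivative σ₁) * (X * derivative σ₃) + 3 * σ₁ * σ₃ * (X * derivative σ₂) ^ 2 - 4 * σ₂ ^ 3 * (X * derivative (X * derivative σ₂))
      - 16 * σ₂ ^ 2 * σ₃ * (X * derivative (X * derivative σ₁)) + 8 * σ₂ ^ 2 * (X * derivative σ₁) * (X * derivative σ₃) + 4 * σ₂ ^ 2 * (X * derivative σ₂) ^ 2
      + 4 * σ₂ * σ₃ * (X * derivative σ₁) * (X * derivative σ₂) + 12 * σ₂ * σ₃ * (X * derivative (X * derivative σ₃)) - 8 * σ₂ * (X * derivative σ₃) ^ 2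
      - 3 * σ₃ ^ 2 * (X * derivative σ₁) ^ 2 + 9 * σ₃ ^ 2 * (X * derivative (X * derivative σ₂)) - 12 * σ₃ * (X * derivative σ₂) * (X * derivative σ₃)).support ⊆ 8 • E := by
  have hT1 : (X * derivative σ₁).support ⊆ 1 • E := supp_theta h1
  have hU1 : (X * derivative (X * derivative σ₁)).support ⊆ 1 • E := supp_theta hT1
  have hT2 : (X * derivative σ₂).support ⊆ 2 • E := supp_theta h2
  have hU2 : (X * derivative (X * derivative σ₂)).support ⊆ 2 • E := supp_theta hT2
  have hT3 : (X * derivative σ₃).support ⊆ 3 • E := supp_theta h3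
  have hU3 : (X * derivative (X * derivative σ₃)).support ⊆ 3 • E := supp_theta hT3
  exact (supp_sub (supp_add (supp_sub (supp_sub (supp_add (supp_add (supp_add (supp_add (supp_sub (supp_sub (supp_add (supp_add (supp_sub (supp_add
    (supp_sub (supp_add (supp_sub (supp_sub (supp_add (supp_sub (supp_sub (supp_sub (supp_sub (supp_add (supp_add (supp_add (supp_add
    (supp_add (supp_add (supp_add (supp_sub (supp_sub (supp_sub (supp_sub (supp_cast (supp_mul (supp_mul (supp_pow h1 5 (by norm_num)) h2)
    hU1) (by norm_num)) (supp_cast (supp_mul (supp_mul (supp_pow h1 4 (by norm_num)) h2) (supp_pow hT1 2 (by norm_num))) (by norm_num)))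
    (supp_cast (supp_mul (supp_mul (supp_pow h1 4 (by norm_num)) h2) hU2) (by norm_num))) (supp_cast (supp_mul (supp_mul (supp_pow h1 4 (by
    norm_num)) h3) hU1) (by norm_num))) (supp_cast (supp_mul (supp_mul (supp_ofNat_mul 6 (supp_pow h1 3 (by norm_num))) (supp_pow h2 2 (by
    norm_num))) hU1) (by norm_num))) (supp_cast (supp_mul (supp_mul (supp_mul (supp_ofNat_mul 4 (supp_pow h1 3 (by norm_num))) h2) hT1) hT2)
    (by norm_num))) (supp_cast (supp_mul (supp_mul (supp_pow h1 3 (by norm_num)) h2) hU3) (by norm_num))) (supp_cast (supp_mul (supp_mul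
    (supp_pow h1 3 (by norm_num)) h3) (supp_pow hT1 2 (by norm_num))) (by norm_num))) (supp_cast (supp_mul (supp_mul (supp_pow h1 3 (by
    norm_num)) h3) hU2) (by norm_num))) (supp_cast (supp_mul (supp_mul (supp_ofNat_mul 2 (supp_pow h1 2 (by norm_num))) (supp_pow h2 2 (by
    norm_num))) (supp_pow hT1 2 (by norm_num))) (by norm_num))) (supp_cast (supp_mul (supp_mul (supp_ofNat_mul 5 (supp_pow h1 2 (by
    norm_num))) (supp_pow h2 2 (by norm_num))) hU2) (by norm_num))) (supp_cast (supp_mul (supp_mul (supp_mul (supp_ofNat_mul 12 (supp_pow h1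
    2 (by norm_num))) h2) h3) hU1) (by norm_num))) (supp_cast (supp_mul (supp_mul (supp_mul (supp_ofNat_mul 6 (supp_pow h1 2 (by norm_num)))
    h2) hT1) hT3) (by norm_num))) (supp_cast (supp_mul (supp_mul (supp_ofNat_mul 3 (supp_pow h1 2 (by norm_num))) h2) (supp_pow hT2 2 (by
    norm_num))) (by norm_num))) (supp_cast (supp_mul (supp_mul (supp_mul (supp_ofNat_mul 4 (supp_pow h1 2 (by norm_num))) h3) hT1) hT2) (by
    norm_num))) (supp_cast (supp_mul (supp_mul (supp_pow h1 2 (by norm_num)) h3) hU3) (by norm_num))) (supp_cast (supp_mul (supp_mul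
    (supp_ofNat_mul 8 h1) (supp_pow h2 3 (by norm_num))) hU1) (by norm_num))) (supp_cast (supp_mul (supp_mul (supp_mul (supp_ofNat_mul 8 h1)
    (supp_pow h2 2 (by norm_num))) hT1) hT2) (by norm_num))) (supp_cast (supp_mul (supp_mul (supp_ofNat_mul 4 h1) (supp_pow h2 2 (by
    norm_num))) hU3) (by norm_num))) (supp_cast (supp_mul (supp_mul (supp_mul h1 h2) h3) (supp_pow hT1 2 (by norm_num))) (by norm_num)))
    (supp_cast (supp_mul (supp_mul (supp_mul (supp_ofNat_mul 10 h1) h2) h3) hU2) (by norm_num))) (supp_cast (supp_mul (supp_mul (supp_mul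
    (supp_ofNat_mul 8 h1) h2) hT2) hT3) (by norm_num))) (supp_cast (supp_mul (supp_mul (supp_ofNat_mul 6 h1) (supp_pow h3 2 (by norm_num)))
    hU1) (by norm_num))) (supp_cast (supp_mul (supp_mul (supp_mul (supp_ofNat_mul 6 h1) h3) hT1) hT3) (by norm_num))) (supp_cast (supp_mul
    (supp_mul (supp_ofNat_mul 3 h1) h3) (supp_pow hT2 2 (by norm_num))) (by norm_num))) (supp_cast (supp_mul (supp_ofNat_mul 4 (supp_pow h2
    3 (by norm_num))) hU2) (by norm_num))) (supp_cast (supp_mul (supp_mul (supp_ofNat_mul 16 (supp_pow h2 2 (by norm_num))) h3) hU1) (by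
    norm_num))) (supp_cast (supp_mul (supp_mul (supp_ofNat_mul 8 (supp_pow h2 2 (by norm_num))) hT1) hT3) (by norm_num))) (supp_cast
    (supp_mul (supp_ofNat_mul 4 (supp_pow h2 2 (by norm_num))) (supp_pow hT2 2 (by norm_num))) (by norm_num))) (supp_cast (supp_mul
    (supp_mul (supp_mul (supp_ofNat_mul 4 h2) h3) hT1) hT2) (by norm_num))) (supp_cast (supp_mul (supp_mul (supp_ofNat_mul 12 h2) h3) hU3)
    (by norm_num))) (supp_cast (supp_mul (supp_ofNat_mul 8 h2) (supp_pow hT3 2 (by norm_num))) (by norm_num))) (supp_cast (supp_mul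
    (supp_ofNat_mul 3 (supp_pow h3 2 (by norm_num))) (supp_pow hT1 2 (by norm_num))) (by norm_num))) (supp_cast (supp_mul (supp_ofNat_mul 9
    (supp_pow h3 2 (by norm_num))) hU2) (by norm_num))) (supp_cast (supp_mul (supp_mul (supp_ofNat_mul 12 h3) hT2) hT3) (by norm_num)))

set_option maxHeartbeats 4000000 in
/-- `supp R₀ ⊆ 9 • E` (every monomial of `R₀` has `E`-weight `9`). [folklore] -/
theorem supp_R0 (σ₁ σ₂ σ₃ : ℝ[X]) (E : Finset ℕ) (h1 : σ₁.support ⊆ 1 • E) (h2 : σ₂.support ⊆ 2 • E)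
    (h3 : σ₃.support ⊆ 3 • E) :
    (σ₁ ^ 5 * σ₃ * (X * derivative (X * derivative σ₁)) - σ₁ ^ 4 * σ₃ * (X * derivative σ₁) ^ 2 - σ₁ ^ 4 * σ₃ * (X * derivative (X * derivative σ₂)) - 6 * σ₁ ^ 3 * σ₂ * σ₃ * (X * derivative (X * derivative σ₁))
      + 4 * σ₁ ^ 3 * σ₃ * (X * derivative σ₁) * (X * derivative σ₂) + σ₁ ^ 3 * σ₃ * (X * derivative (X * derivative σ₃)) + 2 * σ₁ ^ 2 * σ₂ * σ₃ * (X * derivative σ₁) ^ 2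
      + 5 * σ₁ ^ 2 * σ₂ * σ₃ * (X * derivative (X * derivative σ₂)) + 7 * σ₁ ^ 2 * σ₃ ^ 2 * (X * derivative (X * derivative σ₁)) - 6 * σ₁ ^ 2 * σ₃ * (X * derivative σ₁) * (X * derivative σ₃)
      - 3 * σ₁ ^ 2 * σ₃ * (X * derivative σ₂) ^ 2 + 8 * σ₁ * σ₂ ^ 2 * σ₃ * (X * derivative (X * derivative σ₁)) - 8 * σ₁ * σ₂ * σ₃ * (X * derivative σ₁) * (X * derivative σ₂)
      - 4 * σ₁ * σ₂ * σ₃ * (X * derivative (X * derivative σ₃)) + 2 * σ₁ * σ₃ ^ 2 * (X * derivative σ₁) ^ 2 - 6 * σ₁ * σ₃ ^ 2 * (X * derivative (X * derivative σ₂))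
      + 8 * σ₁ * σ₃ * (X * derivative σ₂) * (X * derivative σ₃) - 4 * σ₂ ^ 2 * σ₃ * (X * derivative (X * derivative σ₂)) - 12 * σ₂ * σ₃ ^ 2 * (X * derivative (X * derivative σ₁))
      + 8 * σ₂ * σ₃ * (X * derivative σ₁) * (X * derivative σ₃) + 4 * σ₂ * σ₃ * (X * derivative σ₂) ^ 2 + 9 * σ₃ ^ 2 * (X * derivative (X * derivative σ₃))
      - 9 * σ₃ * (X * derivative σ₃) ^ 2).support ⊆ 9 • E := by
  have hT1 : (X * derivative σ₁).support ⊆ 1 • E := supp_theta h1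
  have hU1 : (X * derivative (X * derivative σ₁)).support ⊆ 1 • E := supp_theta hT1
  have hT2 : (X * derivative σ₂).support ⊆ 2 • E := supp_theta h2
  have hU2 : (X * derivative (X * derivative σ₂)).support ⊆ 2 • E := supp_theta hT2
  have hT3 : (X * derivative σ₃).support ⊆ 3 • E := supp_theta h3
  have hU3 : (X * derivative (X * derivative σ₃)).support ⊆ 3 • E := supp_theta hT3
  exact (supp_sub (supp_add (supp_add (supp_add (supp_sub (supp_sub (supp_add (supp_sub (supp_add (supp_sub (supp_sub (supp_add (supp_sub (supp_sub
    (supp_add (supp_add (supp_add (supp_add (supp_add (supp_sub (supp_sub (supp_sub (supp_cast (supp_mul (supp_mul (supp_pow h1 5 (by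
    norm_num)) h3) hU1) (by norm_num)) (supp_cast (supp_mul (supp_mul (supp_pow h1 4 (by norm_num)) h3) (supp_pow hT1 2 (by norm_num))) (by
    norm_num))) (supp_cast (supp_mul (supp_mul (supp_pow h1 4 (by norm_num)) h3) hU2) (by norm_num))) (supp_cast (supp_mul (supp_mul
    (supp_mul (supp_ofNat_mul 6 (supp_pow h1 3 (by norm_num))) h2) h3) hU1) (by norm_num))) (supp_cast (supp_mul (supp_mul (supp_mul
    (supp_ofNat_mul 4 (supp_pow h1 3 (by norm_num))) h3) hT1) hT2) (by norm_num))) (supp_cast (supp_mul (supp_mul (supp_pow h1 3 (by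
    norm_num)) h3) hU3) (by norm_num))) (supp_cast (supp_mul (supp_mul (supp_mul (supp_ofNat_mul 2 (supp_pow h1 2 (by norm_num))) h2) h3)
    (supp_pow hT1 2 (by norm_num))) (by norm_num))) (supp_cast (supp_mul (supp_mul (supp_mul (supp_ofNat_mul 5 (supp_pow h1 2 (by
    norm_num))) h2) h3) hU2) (by norm_num))) (supp_cast (supp_mul (supp_mul (supp_ofNat_mul 7 (supp_pow h1 2 (by norm_num))) (supp_pow h3 2
    (by norm_num))) hU1) (by norm_num))) (supp_cast (supp_mul (supp_mul (supp_mul (supp_ofNat_mul 6 (supp_pow h1 2 (by norm_num))) h3) hT1)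
    hT3) (by norm_num))) (supp_cast (supp_mul (supp_mul (supp_ofNat_mul 3 (supp_pow h1 2 (by norm_num))) h3) (supp_pow hT2 2 (by norm_num)))
    (by norm_num))) (supp_cast (supp_mul (supp_mul (supp_mul (supp_ofNat_mul 8 h1) (supp_pow h2 2 (by norm_num))) h3) hU1) (by norm_num)))
    (supp_cast (supp_mul (supp_mul (supp_mul (supp_mul (supp_ofNat_mul 8 h1) h2) h3) hT1) hT2) (by norm_num))) (supp_cast (supp_mul
    (supp_mul (supp_mul (supp_ofNat_mul 4 h1) h2) h3) hU3) (by norm_num))) (supp_cast (supp_mul (supp_mul (supp_ofNat_mul 2 h1) (supp_pow h3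
    2 (by norm_num))) (supp_pow hT1 2 (by norm_num))) (by norm_num))) (supp_cast (supp_mul (supp_mul (supp_ofNat_mul 6 h1) (supp_pow h3 2
    (by norm_num))) hU2) (by norm_num))) (supp_cast (supp_mul (supp_mul (supp_mul (supp_ofNat_mul 8 h1) h3) hT2) hT3) (by norm_num)))
    (supp_cast (supp_mul (supp_mul (supp_ofNat_mul 4 (supp_pow h2 2 (by norm_num))) h3) hU2) (by norm_num))) (supp_cast (supp_mul (supp_mul
    (supp_ofNat_mul 12 h2) (supp_pow h3 2 (by norm_num))) hU1) (by norm_num))) (supp_cast (supp_mul (supp_mul (supp_mul (supp_ofNat_mul 8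
    h2) h3) hT1) hT3) (by norm_num))) (supp_cast (supp_mul (supp_mul (supp_ofNat_mul 4 h2) h3) (supp_pow hT2 2 (by norm_num))) (by
    norm_num))) (supp_cast (supp_mul (supp_ofNat_mul 9 (supp_pow h3 2 (by norm_num))) hU3) (by norm_num))) (supp_cast (supp_mul
    (supp_ofNat_mul 9 h3) (supp_pow hT3 2 (by norm_num))) (by norm_num)))

/-- `supp L₁ ⊆ 16 • E` for `L₁ = σ₂R₂² − R₀R₂ − σ₁R₁R₂ + R₁²`. [folklore] -/
theorem supp_L1 {σ₁ σ₂ R₂ R₁ R₀ : ℝ[X]} {E : Finset ℕ} (h1 : σ₁.support ⊆ 1 • E) (h2 : σ₂.support ⊆ 2 • E)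
    (hR2 : R₂.support ⊆ 7 • E) (hR1 : R₁.support ⊆ 8 • E) (hR0 : R₀.support ⊆ 9 • E) :
    (σ₂ * R₂ ^ 2 - R₀ * R₂ - σ₁ * R₁ * R₂ + R₁ ^ 2).support ⊆ 16 • E :=
  supp_add (supp_sub (supp_sub (supp_cast (supp_mul h2 (supp_pow hR2 2 (by norm_num))) (by norm_num))
    (supp_cast (supp_mul hR0 hR2) (by norm_num))) (supp_cast (supp_mul (supp_mul h1 hR1) hR2) (by norm_num)))
    (supp_cast (supp_pow hR1 2 (by norm_num)) (by norm_num))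

/-- `supp L₀ ⊆ 17 • E` for `L₀ = σ₃R₂² − σ₁R₀R₂ + R₀R₁`. [folklore] -/
theorem supp_L0 {σ₁ σ₃ R₂ R₁ R₀ : ℝ[X]} {E : Finset ℕ} (h1 : σ₁.support ⊆ 1 • E) (h3 : σ₃.support ⊆ 3 • E)
    (hR2 : R₂.support ⊆ 7 • E) (hR1 : R₁.support ⊆ 8 • E) (hR0 : R₀.support ⊆ 9 • E) :
    (σ₃ * R₂ ^ 2 - σ₁ * R₀ * R₂ + R₀ * R₁).support ⊆ 17 • E :=
  supp_add (supp_sub (supp_cast (supp_mul h3 (supp_pow hR2 2 (by norm_num))) (by norm_num))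
    (supp_cast (supp_mul (supp_mul h1 hR0) hR2) (by norm_num))) (supp_cast (supp_mul hR0 hR1) (by norm_num))

/-- `supp N ⊆ 41 • E` for `N = R₂L₀² − R₁L₀L₁ + R₀L₁²`. [folklore] -/
theorem supp_N3 {R₂ R₁ R₀ L₁ L₀ : ℝ[X]} {E : Finset ℕ}
    (hR2 : R₂.support ⊆ 7 • E) (hR1 : R₁.support ⊆ 8 • E) (hR0 : R₀.support ⊆ 9 • E)
    (hL1 : L₁.support ⊆ 16 • E) (hL0 : L₀.support ⊆ 17 • E) :
    (R₂ * L₀ ^ 2 - R₁ * L₀ * L₁ + R₀ * L₁ ^ 2).support ⊆ 41 • E :=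
  supp_add (supp_sub (supp_cast (supp_mul hR2 (supp_pow hL0 2 (by norm_num))) (by norm_num))
    (supp_cast (supp_mul (supp_mul hR1 hL0) hL1) (by norm_num))) (supp_cast (supp_mul hR0 (supp_pow hL1 2 (by norm_num))) (by norm_num))

/-- `supp N′ ⊆ 27 • E` for `N′ = σ₃R₁³ − σ₂R₀R₁² + σ₁R₀²R₁ − R₀³`. [folklore] -/
theorem supp_N3' {σ₁ σ₂ σ₃ R₁ R₀ : ℝ[X]} {E : Finset ℕ} (h1 : σ₁.support ⊆ 1 • E) (h2 : σ₂.support ⊆ 2 • E)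
    (h3 : σ₃.support ⊆ 3 • E) (hR1 : R₁.support ⊆ 8 • E) (hR0 : R₀.support ⊆ 9 • E) :
    (σ₃ * R₁ ^ 3 - σ₂ * R₀ * R₁ ^ 2 + σ₁ * R₀ ^ 2 * R₁ - R₀ ^ 3).support ⊆ 27 • E :=
  supp_sub (supp_add (supp_sub (supp_cast (supp_mul h3 (supp_pow hR1 3 (by norm_num))) (by norm_num))
    (supp_cast (supp_mul (supp_mul h2 hR0) (supp_pow hR1 2 (by norm_num))) (by norm_num)))
    (supp_cast (supp_mul (supp_mul h1 (supp_pow hR0 2 (by norm_num))) hR1) (by norm_num)))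
    (supp_cast (supp_pow hR0 3 (by norm_num)) (by norm_num))

/-- A power bookkeeping step: `K^i ≤ K^41` for `1 ≤ i ≤ 41`. [folklore] -/
theorem pow_le_pow_41 (K i : ℕ) (h1 : 1 ≤ i) (h41 : i ≤ 41) : K ^ i ≤ K ^ 41 := by
  rcases Nat.eq_zero_or_pos K with hK | hK
  · subst hK; rw [zero_pow (by omega), zero_pow (by omega)]
  · exact Nat.pow_le_pow_right hK h41

/-- **The numeric form of the count bound**: with `|E| ≤ K` and the support weights above,
`|supp N| + |supp N′| + 3(|supp R₂| + |supp R₁| + |supp R₀| + |supp L₁| + |supp L₀|) ≤ 17·K⁴¹`. [folklore] -/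
theorem bound_le_pow {σ₁ σ₂ σ₃ R₂ R₁ R₀ : ℝ[X]} {E : Finset ℕ} {K : ℕ} (hEK : E.card ≤ K)
    (h1 : σ₁.support ⊆ 1 • E) (h2 : σ₂.support ⊆ 2 • E) (h3 : σ₃.support ⊆ 3 • E)
    (hR2 : R₂.support ⊆ 7 • E) (hR1 : R₁.support ⊆ 8 • E) (hR0 : R₀.support ⊆ 9 • E) :
    (R₂ * (σ₃ * R₂ ^ 2 - σ₁ * R₀ * R₂ + R₀ * R₁) ^ 2
          - R₁ * (σ₃ * R₂ ^ 2 - σ₁ * R₀ * R₂ + R₀ * R₁) * (σ₂ * R₂ ^ 2 - R₀ * R₂ - σ₁ * R₁ * R₂ + R₁ ^ 2)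
          + R₀ * (σ₂ * R₂ ^ 2 - R₀ * R₂ - σ₁ * R₁ * R₂ + R₁ ^ 2) ^ 2).support.card
      + (σ₃ * R₁ ^ 3 - σ₂ * R₀ * R₁ ^ 2 + σ₁ * R₀ ^ 2 * R₁ - R₀ ^ 3).support.card
      + 3 * (R₂.support.card + R₁.support.card + R₀.support.card
          + (σ₂ * R₂ ^ 2 - R₀ * R₂ - σ₁ * R₁ * R₂ + R₁ ^ 2).support.card
          + (σ₃ * R₂ ^ 2 - σ₁ * R₀ * R₂ + R₀ * R₁).support.card) ≤ 17 * K ^ 41 := by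
  have hL1 := supp_L1 h1 h2 hR2 hR1 hR0
  have hL0 := supp_L0 h1 h3 hR2 hR1 hR0
  have cN := (card_support_le_of_subset_nsmul (supp_N3 hR2 hR1 hR0 hL1 hL0)).trans (Nat.pow_le_pow_left hEK 41)
  have cN' := (card_support_le_of_subset_nsmul (supp_N3' h1 h2 h3 hR1 hR0)).trans (Nat.pow_le_pow_left hEK 27)
  have cR2 := (card_support_le_of_subset_nsmul hR2).trans (Nat.pow_le_pow_left hEK 7)
  have cR1 := (card_support_le_of_subset_nsmul hR1).trans (Nat.pow_le_pow_left hEK 8)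
  have cR0 := (card_support_le_of_subset_nsmul hR0).trans (Nat.pow_le_pow_left hEK 9)
  have cL1 := (card_support_le_of_subset_nsmul hL1).trans (Nat.pow_le_pow_left hEK 16)
  have cL0 := (card_support_le_of_subset_nsmul hL0).trans (Nat.pow_le_pow_left hEK 17)
  have e27 := pow_le_pow_41 K 27 (by norm_num) (by norm_num)
  have e7 := pow_le_pow_41 K 7 (by norm_num) (by norm_num)
  have e8 := pow_le_pow_41 K 8 (by norm_num) (by norm_num)
  have e9 := pow_le_pow_41 K 9 (by norm_num) (by norm_num)
  have e16 := pow_le_pow_41 K 16 (by norm_num) (by norm_num)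
  have e17 := pow_le_pow_41 K 17 (by norm_num) (by norm_num)
  omega

end OsculationCuspCubic

end Summit.ValiantsHypothesis.ValiantsHypothesis.Theorems.LacunarySymmetroidMatrixDescartes
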